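import Literature.NumberTheory.EllipticCurves.DeligneSerreWeightOneProofs
import Literature.NumberTheory.EllipticCurves.DeligneSerreWeightOneIrreducible
import Literature.RepresentationTheory.FiniteGroups.CoprimeOrderLiftProofs
import Literature.NumberTheory.GaloisRepresentations.ArtinRepFrobeniusProofs
import Literature.NumberTheory.EllipticCurves.DeligneSerreRankinProofs
import Literature.NumberTheory.EllipticCurves.DeligneSerreRankinProp51Proofs
import Literature.NumberTheory.Automorphic.LanglandsTunnellLSeriesProofs
import Literature.NumberTheory.EllipticCurves.DeligneSerreProp27Proofs
import Literature.NumberTheory.GaloisRepresentations.DeligneSerreGL2SubgroupsProofs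
import Literature.NumberTheory.EllipticCurves.DeligneSerreProp27WeightReductionProofs
import HarnessLib

/-!
# Deligne–Serre 1974, Thm. 4.1: the weight-one theorem from its printed constituents

This file PROVES the named fact `Literature.NumberTheory.EllipticCurves.ModularForms.exists_complexGaloisRep_of_weight_one`
(`Literature.NumberTheory.EllipticCurves.NewformGaloisRep`; Deligne–Serre 1974, Thm. 4.1 with
§3 (a) and Rem. 4.5: a weight-one newform `f ∈ S_1(Γ₁(N))` has an attached continuous
representation `Gal(ℚ̄/ℚ) → GL₂(ℂ)` with finite image, unramified outside `N`, irreducible and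
odd) from the *deep inputs* of the printed proof, each a named fact of the tree carrying the
source's numbering, by combining the three proved constituents

* `thm41_exists_of` (`DeligneSerreWeightOneProofs`; op. cit. §8.2–8.6: existence),
* `thm41_isIrreducible_of` (`DeligneSerreWeightOneIrreducible`; op. cit. §8.7: irreducibility),
* `rem45_isOdd_of` (`NewformGaloisRepOddProofs`, in the tree; op. cit. Rem. 4.4–4.5: oddness)

through `exists_complexGaloisRep_of_weight_one_of` (`NewformGaloisRepProofs`), the proved lifting
theorem `SerreLRFG.prop43_lift_holds` (`CoprimeOrderLiftProofs`; Serre, *Représentations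
linéaires des groupes finis*, §15.5, Prop. 43), the proved Lemme 3.2 `lemma32_complex_of`
(`ArtinRepFrobeniusProofs`, from Chebotarev), the tree's oddness theorem `rem45_isOdd_of`
(`NewformGaloisRepOddProofs`, from Lemme 3.2) and the tree's discharges
`IsNewform1.mem_nebentypusSubspace_nebentypus_holds`, `IsNewform1.heckeEigenvalue_eq_coeff_holds`
(`Literature.NumberTheory.Automorphic.LanglandsTunnellLSeriesProofs`).

The remaining hypotheses are: Thm. 6.7 (mod-`ℓ` representations attached to `f`, resting on
Deligne's Thm. 6.1), Prop. 5.1 and Prop. 5.5 (Rankin), Prop. 7.2 (subgroups of `GL₂(𝔽_ℓ)`),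
the Chebotarev density theorem, and two standard newform facts (`K_f` is a number field;
`a_p, ε(p) ∈ 𝓞_f`).

The variant `exists_complexGaloisRep_of_weight_one_of_facts'` replaces Prop. 5.5 by
Prop. 5.1 and the two assertions of Prop. 2.7 it is deduced from in print
(`prop55_of`, `DeligneSerreRankinProofs`).

Prop. 5.1 is now proved (`prop51_holds`, `DeligneSerreRankinProp51Proofs`): the variants
`exists_complexGaloisRep_of_weight_one_of_facts₁` (hypotheses Thm. 6.7, Prop. 5.5, Prop. 7.2,
Chebotarev, `K_f` a number field, integrality) and `exists_complexGaloisRep_of_weight_one_of_facts₁'`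
(Prop. 5.5 replaced by (2.7.3), (2.7.4)) feed it in.

Prop. 7.2 is now proved as well (`prop72_holds`,
`Literature.NumberTheory.GaloisRepresentations.DeligneSerreGL2SubgroupsProofs`), and Prop. 2.7
((2.7.3), (2.7.4)), the finiteness of `K_f` and the integrality of `a_p, ε(p)` are all
consequences of the single spanning statement (2.7.2) (`DeligneSerre1974_span_integralLattice1`,
`Literature.NumberTheory.EllipticCurves.DeligneSerreProp27Proofs` and
`NewformGaloisRepIntegralityProofs`): `exists_complexGaloisRep_of_weight_one_of_leaves` states
the theorem from exactly the **three remaining deep inputs**, each a named fact carrying its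
printed numbering —

* (A) `thm67_weightOne`: op. cit. Thm. 6.7 in weight one (mod-`ℓ` representations; its printed
  proof 6.8–6.13 rests on Deligne's `λ`-adic representations, Thm. 6.1);
* (B) `Chebotarev.dirichletDensity_eq`: the Chebotarev density theorem over `ℚ` (Neukirch VII
  (13.4)), used in Lemme 8.3 and Lemme 3.2;
* (C) `DeligneSerre1974_span_integralLattice1 N k` for all `N, k`: op. cit. (2.7.2), `S_k(Γ₁(N))`
  is spanned by the lattice `L` of forms all of whose `⟨d⟩`-twists have integral `q`-expansion
  (printed proof: the modular stack, (2.6.1), and the Tate curve, Rem. 2.8).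

The weight-one case of (C) — the only one whose printed proof is purely algebro-geometric — is
proved in the tree from weights `5` and `7` (op. cit. Rem. 2.8 with `E₄, E₆` in place of `Δ`:
`DeligneSerre1974_span_integralLattice1.of_two_le`,
`Literature.NumberTheory.EllipticCurves.DeligneSerreProp27WeightReductionProofs`), so
`exists_complexGaloisRep_of_weight_one_of_leaves₂` needs (C) only in weights `k ≥ 2`, where it is
Shimura 1971, Thm. 3.52 (Eichler–Shimura; the injectivity half of which is proved in
`EichlerShimuraPeriodsGamma1`).

## References

* P. Deligne, J.-P. Serre, *Formes modulaires de poids 1*, Ann. Sci. ÉNS (4) 7 (1974), 507–530,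
  Thm. 4.1, Rem. 4.5, §8.
-/

noncomputable section

open CongruenceSubgroup

namespace Literature.NumberTheory.EllipticCurves.ModularForms.DeligneSerre1974

variable {N : ℕ} [NeZero N]

/-- **The Deligne–Serre theorem (Thm. 4.1 with §3 (a) and Rem. 4.5) from its printed
constituents.** For every newform `f ∈ S_1(Γ₁(N))` there is a continuous representation
`ρ_f : Gal(ℚ̄/ℚ) → GL₂(ℂ)` attached to `f` away from `N`, irreducible, with finite image and odd
(`Literature.NumberTheory.EllipticCurves.ModularForms.exists_complexGaloisRep_of_weight_one`), granted the seven deep inputs of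
Deligne–Serre's proof listed in the module docstring (Thm. 6.7, Prop. 5.1, Prop. 5.5, Prop. 7.2,
Chebotarev, `K_f` a number field, integrality of `a_p, ε(p)`). [cite: DeligneSerreASENS1974, Thm. 4.1 and Rem. 4.5] -/
theorem exists_complexGaloisRep_of_weight_one_of_facts (h67 : thm67_weightOne (N := N))
    (h51 : prop51) (h55 : prop55) (h72 : Literature.NumberTheory.GaloisRepresentations.DeligneSerre1974.prop72)
    (hCheb : LFunctions.Chebotarev.dirichletDensity_eq.{0})
    (hfd : IsNewform1.finiteDimensional_coeffField (N := N) (k := 1))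
    (hint : ∀ f : CuspForm (Gamma1 N) 1, IsNewform1.exists_map_eq_heckePolynomial (f := f)) :
    exists_complexGaloisRep_of_weight_one (N := N) :=
  exists_complexGaloisRep_of_weight_one_of
    (thm41_exists_of h67 h55 h72 hCheb Literature.RepresentationTheory.FiniteGroups.SerreLRFG.prop43_lift_holds
      (Literature.NumberTheory.GaloisRepresentations.DeligneSerre1974.lemma32_complex_of hCheb) hfd
      IsNewform1.mem_nebentypusSubspace_nebentypus_holds IsNewform1.heckeEigenvalue_eq_coeff_holds
      hint)
    (thm41_isIrreducible_of h51 hCheb IsNewform1.mem_nebentypusSubspace_nebentypus_holds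
      IsNewform1.heckeEigenvalue_eq_coeff_holds)
    (rem45_isOdd_of (Literature.NumberTheory.GaloisRepresentations.DeligneSerre1974.lemma32_complex_of hCheb))

/-- **The Deligne–Serre theorem from its printed constituents, with Prop. 5.5 unfolded into
Prop. 5.1 and Prop. 2.7** (`prop55_of`): as `exists_complexGaloisRep_of_weight_one_of_facts`,
with the hypothesis `prop55` replaced by the two assertions of op. cit. Prop. 2.7 (eigenvalues
lie in a number field and are integral; conjugates of eigenforms are eigenforms).
[cite: DeligneSerreASENS1974, Thm. 4.1, Prop. 2.7 and Prop. 5.5] -/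
theorem exists_complexGaloisRep_of_weight_one_of_facts' (h67 : thm67_weightOne (N := N))
    (h51 : prop51) (h273 : prop27_eigenvalues) (h274 : prop27_conj)
    (h72 : Literature.NumberTheory.GaloisRepresentations.DeligneSerre1974.prop72) (hCheb : LFunctions.Chebotarev.dirichletDensity_eq.{0})
    (hfd : IsNewform1.finiteDimensional_coeffField (N := N) (k := 1))
    (hint : ∀ f : CuspForm (Gamma1 N) 1, IsNewform1.exists_map_eq_heckePolynomial (f := f)) :
    exists_complexGaloisRep_of_weight_one (N := N) :=
  exists_complexGaloisRep_of_weight_one_of_facts h67 h51 (prop55_of h51 h273 h274) h72 hCheb hfd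
    hint

/-- **The Deligne–Serre theorem from its printed constituents, Prop. 5.1 being proved**
(`prop51_holds`): as `exists_complexGaloisRep_of_weight_one_of_facts` without the hypothesis
`prop51` — six deep inputs remain (Thm. 6.7, Prop. 5.5, Prop. 7.2, Chebotarev, `K_f` a number
field, integrality of `a_p, ε(p)`). [cite: DeligneSerreASENS1974, Thm. 4.1, Rem. 4.5 and Prop. 5.1] -/
theorem exists_complexGaloisRep_of_weight_one_of_facts₁ (h67 : thm67_weightOne (N := N))
    (h55 : prop55) (h72 : Literature.NumberTheory.GaloisRepresentations.DeligneSerre1974.prop72)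
    (hCheb : LFunctions.Chebotarev.dirichletDensity_eq.{0})
    (hfd : IsNewform1.finiteDimensional_coeffField (N := N) (k := 1))
    (hint : ∀ f : CuspForm (Gamma1 N) 1, IsNewform1.exists_map_eq_heckePolynomial (f := f)) :
    exists_complexGaloisRep_of_weight_one (N := N) :=
  exists_complexGaloisRep_of_weight_one_of_facts h67 prop51_holds h55 h72 hCheb hfd hint

/-- **The Deligne–Serre theorem from its printed constituents, Prop. 5.1 being proved and
Prop. 5.5 unfolded into Prop. 2.7** (`prop51_holds`, `prop55_of`): hypotheses Thm. 6.7, (2.7.3),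
(2.7.4), Prop. 7.2, Chebotarev, `K_f` a number field, integrality of `a_p, ε(p)`.
[cite: DeligneSerreASENS1974, Thm. 4.1, Prop. 2.7, Prop. 5.1 and Prop. 5.5] -/
theorem exists_complexGaloisRep_of_weight_one_of_facts₁' (h67 : thm67_weightOne (N := N))
    (h273 : prop27_eigenvalues) (h274 : prop27_conj) (h72 : Literature.NumberTheory.GaloisRepresentations.DeligneSerre1974.prop72)
    (hCheb : LFunctions.Chebotarev.dirichletDensity_eq.{0})
    (hfd : IsNewform1.finiteDimensional_coeffField (N := N) (k := 1))
    (hint : ∀ f : CuspForm (Gamma1 N) 1, IsNewform1.exists_map_eq_heckePolynomial (f := f)) :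
    exists_complexGaloisRep_of_weight_one (N := N) :=
  exists_complexGaloisRep_of_weight_one_of_facts' h67 prop51_holds h273 h274 h72 hCheb hfd hint

/-- **The Deligne–Serre theorem (Thm. 4.1 with §3 (a) and Rem. 4.5) from its three remaining
deep inputs.** For every newform `f ∈ S_1(Γ₁(N))` there is a continuous representation
`ρ_f : Gal(ℚ̄/ℚ) → GL₂(ℂ)` attached to `f` away from `N`, irreducible, with finite image and odd
(`Literature.NumberTheory.EllipticCurves.ModularForms.exists_complexGaloisRep_of_weight_one`),
granted (A) op. cit. Thm. 6.7 in weight one (`thm67_weightOne`), (B) the Chebotarev density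
theorem (`Chebotarev.dirichletDensity_eq`) and (C) op. cit. (2.7.2) for all levels and weights
(`DeligneSerre1974_span_integralLattice1`). Everything else in the printed proof is proved in the
tree: Prop. 5.1 (`prop51_holds`), Prop. 5.5 from 5.1 and 2.7 (`prop55_of`), Prop. 2.7 from
(2.7.2) (`prop27_eigenvalues_of_span_integralLattice1`, `prop27_conj_of_span_integralLattice1`,
`IsNewform1.finiteDimensional_coeffField_of_span_integralLattice1`,
`IsNewform1.exists_map_eq_heckePolynomial_of_span_integralLattice1`), Prop. 7.2 (`prop72_holds`),
Lemme 3.2, Lemme 6.11, §8.3–8.7 and Rem. 4.5 (see `exists_complexGaloisRep_of_weight_one_of_facts`).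
[cite: DeligneSerreASENS1974, Thm. 4.1, Rem. 4.5, Prop. 2.7 (2.7.2), Thm. 6.7] -/
theorem exists_complexGaloisRep_of_weight_one_of_leaves (h67 : thm67_weightOne (N := N))
    (hCheb : LFunctions.Chebotarev.dirichletDensity_eq.{0})
    (hL : ∀ (M : ℕ) [NeZero M] (k : ℤ), DeligneSerre1974_span_integralLattice1 M k) :
    exists_complexGaloisRep_of_weight_one (N := N) :=
  exists_complexGaloisRep_of_weight_one_of_facts' h67 prop51_holds
    (prop27_eigenvalues_of_span_integralLattice1 hL) (prop27_conj_of_span_integralLattice1 hL)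
    Literature.NumberTheory.GaloisRepresentations.DeligneSerre1974.prop72_holds hCheb
    (IsNewform1.finiteDimensional_coeffField_of_span_integralLattice1 (hL N 1))
    (fun _ ↦ IsNewform1.exists_map_eq_heckePolynomial_of_span_integralLattice1 (hL N 1))

/-- **The Deligne–Serre theorem from Thm. 6.7, Chebotarev, and (2.7.2) in weights `≥ 2` only.**
As `exists_complexGaloisRep_of_weight_one_of_leaves`, but the spanning statement (2.7.2)
(`DeligneSerre1974_span_integralLattice1`) is assumed only for weights `k ≥ 2` — where it is
Shimura 1971, Thm. 3.52 — the weight-one case being proved from weights `5` and `7`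
(`DeligneSerre1974_span_integralLattice1.of_two_le`, op. cit. Rem. 2.8). These three hypotheses
are the deep inputs of the printed proof that the tree does not prove: Deligne's `λ`-adic
representations (behind Thm. 6.7), the Chebotarev density theorem (Lemme 8.3), and the
Eichler–Shimura rational structure of `S_k(Γ₁(N))`, `k ≥ 2`.
[cite: DeligneSerreASENS1974, Thm. 4.1, Rem. 2.8, Rem. 4.5, Thm. 6.7] -/
theorem exists_complexGaloisRep_of_weight_one_of_leaves₂ (h67 : thm67_weightOne (N := N))
    (hCheb : LFunctions.Chebotarev.dirichletDensity_eq.{0})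
    (hL : ∀ (M : ℕ) [NeZero M] (k : ℤ), 2 ≤ k → DeligneSerre1974_span_integralLattice1 M k) :
    exists_complexGaloisRep_of_weight_one (N := N) :=
  exists_complexGaloisRep_of_weight_one_of_leaves h67 hCheb
    fun M _ k ↦ DeligneSerre1974_span_integralLattice1.of_two_le (hL M) k

/-! ### Thm. 4.1 (existence) alone, from the three remaining leaves

The named fact `thm41_exists` (`Literature.NumberTheory.EllipticCurves.NewformGaloisRepProofs`;
op. cit. Thm. 4.1, first assertion, with §3 (a)) assembled DIRECTLY through `thm41_exists_of`
(`DeligneSerreWeightOneProofs`, op. cit. §8.5–8.6) with every input that the tree proves fed in: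
Prop. 5.1 (`prop51_holds`), Prop. 5.5 from 5.1 and Prop. 2.7 (`prop55_of`), Prop. 7.2
(`prop72_holds`), the lifting of prime-to-`ℓ` representations (`SerreLRFG.prop43_lift_holds`),
Lemme 3.2 — unconditionally, through Frobenius' density theorem (`lemma32_complex_holds`) — and
the newform facts `mem_nebentypusSubspace_nebentypus_holds`, `heckeEigenvalue_eq_coeff_holds`;
Prop. 2.7 ((2.7.3), (2.7.4)), `K_f` a number field and the integrality of the Hecke polynomial
come from (2.7.2) (`DeligneSerre1974_span_integralLattice1`).  What is left is exactly:
(A) Thm. 6.7 in weight one (`thm67_weightOne`), (B) Chebotarev's density theorem over `ℚ`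
(`Chebotarev.dirichletDensity_eq`, used in Lemme 8.3 only), (C) (2.7.2) — in all weights
(`thm41_exists_of_leaves`) or in weights `≥ 2` only (`thm41_exists_of_leaves₂`, the weight-one
case being `DeligneSerre1974_span_integralLattice1.of_two_le`). -/

/-- **Deligne–Serre 1974, Thm. 4.1 (existence, with §3 (a)) from its three remaining deep
inputs.** For every newform `f ∈ S_1(Γ₁(N))` there is a continuous representation
`Gal(ℚ̄/ℚ) → GL₂(ℂ)` with finite image attached to `f` away from `N` (`thm41_exists`), granted
(A) op. cit. Thm. 6.7 in weight one (`thm67_weightOne`), (B) the Chebotarev density theorem over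
`ℚ` (`Chebotarev.dirichletDensity_eq`, Lemme 8.3) and (C) op. cit. (2.7.2) for all levels and
weights (`DeligneSerre1974_span_integralLattice1`); everything else in the printed proof
(§8.2–8.6: Prop. 5.1, Prop. 5.5, Prop. 7.2, Lemme 3.2, the lift of 8.6, Prop. 2.7) is proved in
the tree and fed in here. [cite: DeligneSerreASENS1974, Thm. 4.1 and §8.2–8.6] -/
theorem thm41_exists_of_leaves (h67 : thm67_weightOne (N := N))
    (hCheb : LFunctions.Chebotarev.dirichletDensity_eq.{0})
    (hL : ∀ (M : ℕ) [NeZero M] (k : ℤ), DeligneSerre1974_span_integralLattice1 M k) :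
    thm41_exists (N := N) :=
  thm41_exists_of h67
    (prop55_of prop51_holds (prop27_eigenvalues_of_span_integralLattice1 hL)
      (prop27_conj_of_span_integralLattice1 hL))
    Literature.NumberTheory.GaloisRepresentations.DeligneSerre1974.prop72_holds hCheb
    Literature.RepresentationTheory.FiniteGroups.SerreLRFG.prop43_lift_holds
    Literature.NumberTheory.GaloisRepresentations.DeligneSerre1974.lemma32_complex_holds
    (IsNewform1.finiteDimensional_coeffField_of_span_integralLattice1 (hL N 1))
    IsNewform1.mem_nebentypusSubspace_nebentypus_holds IsNewform1.heckeEigenvalue_eq_coeff_holds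
    (fun _ ↦ IsNewform1.exists_map_eq_heckePolynomial_of_span_integralLattice1 (hL N 1))

/-- **Deligne–Serre 1974, Thm. 4.1 (existence) from Thm. 6.7, Chebotarev, and (2.7.2) in weights
`≥ 2` only** — the range where (2.7.2) is Shimura 1971, Thm. 3.52 (op. cit. Rem. 2.8); the
weight-one case of (2.7.2) needed for `K_f`, Prop. 2.7 and the integrality of `a_p, ε(p)` is
derived from weights `5` and `7` (`DeligneSerre1974_span_integralLattice1.of_two_le`).
[cite: DeligneSerreASENS1974, Thm. 4.1, Rem. 2.8 and §8.2–8.6] -/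
theorem thm41_exists_of_leaves₂ (h67 : thm67_weightOne (N := N))
    (hCheb : LFunctions.Chebotarev.dirichletDensity_eq.{0})
    (hL : ∀ (M : ℕ) [NeZero M] (k : ℤ), 2 ≤ k → DeligneSerre1974_span_integralLattice1 M k) :
    thm41_exists (N := N) :=
  thm41_exists_of_leaves h67 hCheb fun M _ k ↦ DeligneSerre1974_span_integralLattice1.of_two_le (hL M) k

end Literature.NumberTheory.EllipticCurves.ModularForms.DeligneSerre1974
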